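import Mathlib
import HarnessLib
import Summits.QuantumAdvantage.QuantumAdvantage.Theorems.PumpDialG
import Summits.QuantumAdvantage.QuantumAdvantage.Theses.AbsorptionDial

/-!
# PumpDial, part H (the junction onto AbsorptionDial.NoPerfectPolyOdd) — support for item stmt-QuantumAdvantage-28487

Cell decomp-qadv, seat lens-4 («minimal counterexample / extremal reduction»), generation 25 — land port of the node
«PumpDial» (published under the cell's HOME/decomp-qadv-lens-4/g25/PumpDial.lean rev 3, sha256 59c460875773e61d…, record NODE-g25.md;
RESIDUAL MODE on AbsorptionDial:28487 `NoPerfectPolyOdd`).  The node file with ONLY the namespace renamed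
`Theses.PumpDial → Theorems.PumpDial`, `example`s dropped and one-line docstrings added where missing, cut into chain-imported parts;
the X-side junction theorems (conclusion `AbsorptionDial.NoPerfectPolyOdd` BY NAME) live in the LAST part, the only one importing
`Theses.AbsorptionDial`; every other part imports only `AdviceFreeQNC0.*`, `Literature.Computability.MetaComplexity.*`, HarnessLib, Mathlib
(no import path to any Theses file — checked on the tree's import lines), so route items can be typed BY NAME over these parts.
No `sorry`, no new axioms, no instances, no notation.

This part: the X-side junction — `Target`, `closes`, `closes_X'`, `closes_X_poly`, `closes_X_polyE`, node summaries (23 declarations).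
-/

set_option autoImplicit false
set_option linter.dupNamespace false

noncomputable section

namespace Summit.QuantumAdvantage.QuantumAdvantage.Theorems.PumpDial
open Classical
open Finset
open Summit.QuantumAdvantage.AdviceFreeQNC0
open Summit.QuantumAdvantage.AdviceFreeQNC0.TwoShot
open Summit.QuantumAdvantage.AdviceFreeQNC0.CharK
open Literature.Computability.MetaComplexity Literature.Computability.MetaComplexity.Smolensky
open Summit.QuantumAdvantage.QuantumAdvantage.Theses

section Node


/-! ## §5 The node: pieces, the deciding theorems, honesty -/

/-- TARGET (verbatim the live crux `stmt-QuantumAdvantage-28487` of `route-QuantumAdvantage-AbsorptionDial`). -/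
def Target : Prop := AbsorptionDial.NoPerfectPolyOdd

/-- `target_iff` (PumpDial g25, section Node). -/
theorem target_iff : Target ↔ AbsorptionDial.NoPerfectPolyOdd := Iff.rfl

/-- **`X ⟺ X on ODD DIAGONAL boards`** (the §4b transfer LAW, proved): an EQUIVALENT reformulation, recorded as a law —
not a piece. -/
theorem target_iff_hard : Target ↔ NoPerfectPolyHardOdd := by
  constructor
  · intro hX p _ hp C
    obtain ⟨n₀, hn₀⟩ := hX p hp C
    exact ⟨n₀, fun n hn c _ y hy => hn₀ n hn c y hy⟩
  · intro hH p _ hp C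
    obtain ⟨n₀, hn₀⟩ := hH p hp (2 * C + 3)
    refine ⟨max (n₀ + 1) 16, fun n hn c y hy => ?_⟩
    by_contra hno
    push Not at hno
    have hwin : Perfect c y := fun u => by
      cases h : ringWinU c y u
      · exact absurd h (hno u)
      · rfl
    have h16 : 16 ≤ n := le_trans (le_max_right _ _) hn
    have hn0 : n₀ + 1 ≤ n := le_trans (le_max_left _ _) hn
    obtain ⟨n', c', hn', hB, y', hy', hdeg'⟩ := hard_of_perfAt (p := p) (by omega) ⟨y, hwin, hy⟩
    have hnn' : n ≤ n' + 1 := by rcases hn' with rfl | rfl | rfl <;> omega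
    obtain ⟨u, hu⟩ := hn₀ n' (by omega) c' hB y' fun g => lowDeg_mono (polylog_bump h16 hnn') (hdeg' g)
    rw [hy' u] at hu
    cases hu

/-- `target_iff_diag` (PumpDial g25, section Node). -/
theorem target_iff_diag : Target ↔ NoPerfectPolyDiagOdd := by
  constructor
  · intro hX p _ hp C
    obtain ⟨n₀, hn₀⟩ := hX p hp C
    exact ⟨n₀, fun n hn c _ y hy => hn₀ n hn c y hy⟩
  · intro hD p _ hp C
    obtain ⟨n₀, hn₀⟩ := hD p hp (C + 1)
    refine ⟨max n₀ 4, fun n hn c y hy => ?_⟩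
    by_contra hno
    push Not at hno
    have hwin : Perfect c y := fun u => by
      cases h : ringWinU c y u
      · exact absurd h (hno u)
      · rfl
    obtain ⟨m, e, hm, he, y', hy', hdeg'⟩ := diag_of_perfAt (p := p) ⟨y, hwin, hy⟩
    have hnm : n ≤ m := by rcases hm with rfl | rfl <;> omega
    have h4 : 4 ≤ n := le_trans (le_max_right _ _) hn
    have hm₀ : n₀ ≤ m := by have := le_max_left n₀ 4; omega
    obtain ⟨u, hu⟩ := hn₀ m hm₀ e he y' fun g => lowDeg_mono (pow_log_succ_le h4 hnm) (hdeg' g)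
    rw [hy' u] at hu
    cases hu


/-- **THE DECIDING THEOREM (K-linear form)** — conclusion is the route decl `AbsorptionDial.NoPerfectPolyOdd` BY NAME;
both binders used: a putative perfect strategy is moved to an odd diagonal board of length `n' ∈ {n−1, n, n+1}` (§4b LAW,
proved), turned into a K-linear unity on that board by `A_K`, which `B_K` forbids. -/
theorem closes (hA : HardToUnityOdd) (hB : NoUnityHardOdd) : AbsorptionDial.NoPerfectPolyOdd := by
  intro p _ hp C
  obtain ⟨C', n₀, h₀⟩ := hA p hp (2 * C + 3)
  obtain ⟨n₁, h₁⟩ := hB p hp C'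
  refine ⟨max (n₀ + n₁ + 1) 16, fun n hn c y hy => ?_⟩
  by_contra hno
  push Not at hno
  have hwin : Perfect c y := fun u => by
    cases h : ringWinU c y u
    · exact absurd h (hno u)
    · rfl
  have h16 : 16 ≤ n := le_trans (le_max_right _ _) hn
  have hn01 : n₀ + n₁ + 1 ≤ n := le_trans (le_max_left _ _) hn
  obtain ⟨n', c', hn', hH, hP'⟩ := hard_of_perfAt (p := p) (by omega) ⟨y, hwin, hy⟩
  have hnn' : n ≤ n' + 1 := by rcases hn' with rfl | rfl | rfl <;> omega
  have hU := h₀ n' (by omega) c' hH (perfAt_mono (polylog_bump h16 hnn') hP')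
  exact h₁ n' (by omega) c' hH hU

/-- `closes_target` (PumpDial g25, section Node). -/
theorem closes_target (hA : HardToUnityOdd) (hB : NoUnityHardOdd) : Target := closes hA hB

/-- necessity of `A_K`: `X ⟹ A_K` (vacuously — under `X` no large board is perfect at polylog degree). -/
theorem aK_of_target (hX : Target) : HardToUnityOdd := by
  intro p _ hp C
  obtain ⟨n₀, hn₀⟩ := hX p hp C
  refine ⟨C, n₀, fun n hn c _ hP => ?_⟩
  obtain ⟨y, hy, hdeg⟩ := hP
  obtain ⟨u, hu⟩ := hn₀ n hn c y hdeg
  rw [hy u] at hu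
  cases hu

/-- **THE DECIDING THEOREM (Boolean form)**: `A → B → X`, conclusion BY NAME, both binders used. -/
theorem closes_bool (hA : HardToOneLiveOdd) (hB : NoOneLiveHardOdd) : AbsorptionDial.NoPerfectPolyOdd := by
  intro p _ hp C
  obtain ⟨C', n₀, h₀⟩ := hA p hp (2 * C + 3)
  obtain ⟨n₁, h₁⟩ := hB p hp C'
  refine ⟨max (n₀ + n₁ + 1) 16, fun n hn c y hy => ?_⟩
  by_contra hno
  push Not at hno
  have hwin : Perfect c y := fun u => by
    cases h : ringWinU c y u
    · exact absurd h (hno u)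
    · rfl
  have h16 : 16 ≤ n := le_trans (le_max_right _ _) hn
  have hn01 : n₀ + n₁ + 1 ≤ n := le_trans (le_max_left _ _) hn
  obtain ⟨n', c', hn', hH, hP'⟩ := hard_of_perfAt (p := p) (by omega) ⟨y, hwin, hy⟩
  have hnn' : n ≤ n' + 1 := by rcases hn' with rfl | rfl | rfl <;> omega
  obtain ⟨y', h1', hdeg'⟩ := h₀ n' (by omega) c' hH (perfAt_mono (polylog_bump h16 hnn') hP')
  obtain ⟨u, hu⟩ := h₁ n' (by omega) c' hH y' hdeg'
  exact hu (h1' u)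

/-- necessity: `X ⟹ B`. -/
theorem b_of_target (hX : Target) : NoOneLiveHardOdd := by
  intro p _ hp C
  obtain ⟨n₀, hn₀⟩ := hX p hp C
  refine ⟨n₀, fun n hn c _ y hy => ?_⟩
  obtain ⟨u, hu⟩ := hn₀ n hn c y hy
  exact ⟨u, liveCount_ne_one_of_loss hu⟩

/-- necessity: `X ⟹ A` (vacuous). -/
theorem a_of_target (hX : Target) : HardToOneLiveOdd := by
  intro p _ hp C
  obtain ⟨n₀, hn₀⟩ := hX p hp C
  refine ⟨C, n₀, fun n hn c _ hP => ?_⟩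
  obtain ⟨y, hy, hdeg⟩ := hP
  obtain ⟨u, hu⟩ := hn₀ n hn c y hdeg
  rw [hy u] at hu
  cases hu

/-- EXACT junction of the Boolean node: `X ⟺ A ∧ B`. -/
theorem target_iff_pieces : Target ↔ (HardToOneLiveOdd ∧ NoOneLiveHardOdd) :=
  ⟨fun h => ⟨a_of_target h, b_of_target h⟩, fun h => closes_bool h.1 h.2⟩

/-- HONESTY (normal-form split): once `B` is a theorem, `A ≡ X`; once `A` is, `B ≡ X`. -/
theorem a_iff_target_of_b (hB : NoOneLiveHardOdd) : HardToOneLiveOdd ↔ Target :=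
  ⟨fun hA => closes_bool hA hB, a_of_target⟩

/-- `b_iff_target_of_a` (PumpDial g25, section Node). -/
theorem b_iff_target_of_a (hA : HardToOneLiveOdd) : NoOneLiveHardOdd ↔ Target :=
  ⟨fun hB => closes_bool hA hB, b_of_target⟩

/-- **THE DECIDING THEOREM (dual form)**: `A_K → B_D → X`, conclusion `AbsorptionDial.NoPerfectPolyOdd` BY NAME. -/
theorem closes_design (hA : HardToUnityOdd) (hD : DesignsHardOdd) : AbsorptionDial.NoPerfectPolyOdd :=
  closes hA (designsHard_iff_noUnityHard.mp hD)

end Node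


/-! ## §7 Summary -/

/-- NODE SUMMARY.  Deciding theorems BY NAME: `closes : A_K → B_K → X`, `closes_bool : A → B → X`; laws
`X ⟺ X_diag ⟺ X_hard` (board transfer, proved), `X ⟹ A`, `X ⟹ B`, `X ⟺ A ∧ B`, `A ⟹ A_K`, `B_K ⟹ B`;
calibration `A(3) ∧ A_K(3) ∧ ¬B(3) ∧ ¬B_K(3)`; dual form `closes_design : A_K → B_D → X` with `B_D ⟺ B_K`
(designs ↔ no unity, finite-dimensional duality). -/
theorem node_summary :
    (HardToUnityOdd → NoUnityHardOdd → AbsorptionDial.NoPerfectPolyOdd) ∧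
    (HardToOneLiveOdd → NoOneLiveHardOdd → AbsorptionDial.NoPerfectPolyOdd) ∧
    (Target ↔ NoPerfectPolyDiagOdd) ∧ (Target ↔ NoPerfectPolyHardOdd) ∧
    (Target ↔ (HardToOneLiveOdd ∧ NoOneLiveHardOdd)) ∧
    (HardToOneLiveOdd → HardToUnityOdd) ∧ (NoUnityHardOdd → NoOneLiveHardOdd) ∧
    HardToOneLiveAt 3 ∧ HardToUnityAt 3 ∧ ¬ NoOneLiveHardAt 3 ∧ ¬ NoUnityHardAt 3 ∧
    (HardToUnityOdd → DesignsHardOdd → AbsorptionDial.NoPerfectPolyOdd) ∧ (DesignsHardOdd ↔ NoUnityHardOdd) :=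
  ⟨closes, closes_bool, target_iff_diag, target_iff_hard, target_iff_pieces, a_imp_aK, bK_imp_b,
    hardToOneLiveAt_three, hardToUnityAt_three, not_noOneLiveHardAt_three, not_noUnityHardAt_three,
    closes_design, designsHard_iff_noUnityHard⟩

section NodeX


/-! ## §15 THE NODE AT THE RESIDUAL (conclusion `AbsorptionDial.NoPerfectPolyOdd` BY NAME) -/

/-- **DECIDING THEOREM of generation 25**: `A_K → BASE → PUMP → X`, conclusion the route decl
`AbsorptionDial.NoPerfectPolyOdd` (item 28487) BY NAME, all three binders used: `BASE ∧ PUMP` give the linear unity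
degree `LUD` (§13), linear beats polylog gives g24's `B_K = NoUnityHardOdd` (`closes_K`), and g24's `closes`
(`A_K → B_K → X`, Part I §5 verbatim) finishes. -/
theorem closes_X (hA : HardToUnityOdd) (hBase : UnityBase) (hPump : UnityPump) :
    AbsorptionDial.NoPerfectPolyOdd :=
  closes hA (closes_K hBase hPump)

/-- ledger of generation 25 (everything after `→`/`↔` below is kernel-checked here). -/
theorem node_summary_g25 :
    (UnityBase → UnityPump → NoUnityHardOdd) ∧ (UnityBase → UnityPump → NoUnityEvenOdd) ∧
    (UnityBase → UnityPump → NoOneLiveHardOdd) ∧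
    (HardToUnityOdd → UnityBase → UnityPump → AbsorptionDial.NoPerfectPolyOdd) ∧
    (LinearUnityDegree → NoUnityHardOdd) ∧ (UnityThird → NoUnityHardOdd) ∧ (NoUnityHardOdd ↔ NoUnityEvenOdd) :=
  ⟨closes_K, closes_K_even, closes_B, closes_X, closes_K_of_lud, closes_K_of_third, noUnityHardOdd_iff_even⟩

end NodeX

section BaseKernel

variable {K : Type*} [Field K]

/-- **the node at the residual, BASE discharged: `X ⟸ A_K ∧ PUMP`** (by name). -/
theorem closes_X' (hA : HardToUnityOdd) (hPump : UnityPump) :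
    Summit.QuantumAdvantage.QuantumAdvantage.Theses.AbsorptionDial.NoPerfectPolyOdd :=
  closes_X hA unityBase_holds hPump

/-- `node_summary_g25'` (PumpDial g25, section BaseKernel). -/
theorem node_summary_g25' :
    UnityBase ∧ (UnityPump → NoUnityHardOdd) ∧ (UnityPump → NoOneLiveHardOdd) ∧
    (HardToUnityOdd → UnityPump → Summit.QuantumAdvantage.QuantumAdvantage.Theses.AbsorptionDial.NoPerfectPolyOdd) :=
  ⟨unityBase_holds, closes_K', closes_B', closes_X'⟩

end BaseKernel

section PolyPump

variable {p : ℕ} [Fact p.Prime]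

/-- **`A_K → PolyPump k → X`** (conclusion the route decl BY NAME). -/
theorem closes_X_poly {k : ℕ} (hA : HardToUnityOdd) (hP : PolyPump k) :
    Summit.QuantumAdvantage.QuantumAdvantage.Theses.AbsorptionDial.NoPerfectPolyOdd :=
  closes hA (closes_K_poly hP)

/-- `node_summary_poly` (PumpDial g25, section PolyPump). -/
theorem node_summary_poly (k : ℕ) :
    (UnityPump → PolyPump 0) ∧ (PolyPump k → NoUnityHardOdd) ∧ (PolyPump k → NoOneLiveHardOdd) ∧
    (HardToUnityOdd → PolyPump k →
      Summit.QuantumAdvantage.QuantumAdvantage.Theses.AbsorptionDial.NoPerfectPolyOdd) :=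
  ⟨polyPump_zero_of_pump, closes_K_poly, closes_B_poly, closes_X_poly⟩

end PolyPump

section PolyPumpE

variable {p : ℕ} [Fact p.Prime]

/-- **`A_K → PolyPumpE k → X`** (the route decl BY NAME). -/
theorem closes_X_polyE {k : ℕ} (hA : HardToUnityOdd) (hP : PolyPumpE k) :
    Summit.QuantumAdvantage.QuantumAdvantage.Theses.AbsorptionDial.NoPerfectPolyOdd :=
  closes hA (closes_K_polyE hP)

/-- `node_summary_polyE` (PumpDial g25, section PolyPumpE). -/
theorem node_summary_polyE (k k' : ℕ) (hk : k ≤ k') :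
    (UnityPump → PolyPumpE 0) ∧ (PolyPump k → PolyPumpE k) ∧ (PolyPumpE k → PolyPumpE k') ∧
    (PolyPumpE k → NoUnityHardOdd) ∧
    (HardToUnityOdd → PolyPumpE k →
      Summit.QuantumAdvantage.QuantumAdvantage.Theses.AbsorptionDial.NoPerfectPolyOdd) :=
  ⟨polyPumpE_zero_of_pump, polyPumpE_of_polyPump', polyPumpE_chain hk, closes_K_polyE, closes_X_polyE⟩

end PolyPumpE

end Summit.QuantumAdvantage.QuantumAdvantage.Theorems.PumpDial
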